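import Mathlib

/-!
# `SnSubsetDichotomy.HyperoctahedralThreshold` — stub `stub_mobiusGadget`

The Möbius gadget (crux `stmt-MatrixMultiplication-10883`, registered stub `stub_mobiusGadget` of
the lead's skeleton for line `refutation-local-symmetry`).

Data: three involutions `μ 0, μ 1, μ 2` of `Fin n` and a clean *Möbius cycle* of the rung graph:
`k + 2` rungs `{p i, q i}` (`i : Fin (k + 2)`, all `2 (k + 2)` points distinct); for
`j : Fin (k + 1)` the step of colour `col j.castSucc` maps rung `j.castSucc` onto rung `j.succ`
preserving the sides (`p ↦ p`, `q ↦ q`), and the closing step of colour `col (Fin.last (k + 1))`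
maps the last rung onto rung `0` with the sides *swapped* (`p last ↦ q 0`, `q last ↦ p 0`);
consecutive step colours differ, including the wrap.  Claim: a commuting pair of involutions
`a, b`, not both trivial, supported on the points of the cycle, with `a ∈ C(μ 0)`, `b ∈ C(μ 1)`
and `a * b ∈ C(μ 2)`.

Proof.  In the cyclic arithmetic of `Fin (k + 2)` the step into rung `i` has colour `col (i - 1)`
(`0 - 1 = Fin.last (k + 1)`, `j.succ - 1 = j.castSucc`) and the step out of rung `i` has colour
`col i`; rung `i` *sees* these two (distinct) colours.  Encode the points by the injection
`g : Fin (k + 2) × Bool → Fin n`, `(i, false) ↦ p i`, `(i, true) ↦ q i`, let `e c` be the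
involution of `Fin (k + 2) × Bool` flipping the Boolean coordinate over the rungs seeing `c`, and
let `A c` be its extension along `g` (`Equiv.Perm.extendDomain`), i.e. the product of the
transpositions `(p i q i)` over the rungs seeing `c`.  Since every rung sees exactly two of the
three colours, `e 0 * e 1 = e 2`; all `e c` commute and square to `1`, hence so do the `A c`, and
we take `a := A 0`, `b := A 1` (so `a * b = A 2`).  Commutation `A c ∈ C(μ c)`
(`MobiusGadget.extendDomain_flip_comm`, `MobiusGadget.rung_map`): if rung `i` sees `c` then `μ c`
maps the rung `{p i, q i}` onto a rung `{p j, q j}` which again sees `c` — the neighbouring rung,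
sides preserved, along an inner step (walked backwards with `μ c * μ c = 1` when `c` is the
incoming colour), and sides swapped along the wrap step — and the rung flips are blind to the
swap of sides; a point not on a rung seeing `c` is fixed by `A c`, and so is its `μ c`-image
(otherwise, applying the involution `μ c`, the point itself would lie on a rung seeing `c`).
Finally rung `0` sees two distinct colours, one of which is `0` or `1`, so
`a (p 0) = q 0 ≠ p 0` or `b (p 0) = q 0 ≠ p 0`.
-/

namespace Summit.MatrixMultiplication.MatrixMultiplication.Theorems.HyperoctahedralThreshold

open Equiv

namespace MobiusGadget

/-- The embedded rung flip along `R` — rung `j` realised as the pair `g (j, false)`,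
`g (j, true)`, the flip `e` of the Boolean coordinate over the rungs seeing `R` extended along the
injection `g` by `Equiv.Perm.extendDomain` — commutes with an involution `μ` carrying every rung
seeing `R` onto a rung seeing `R`, the two sides preserved or swapped. [folklore] -/
theorem extendDomain_flip_comm {ι β : Type*} {g : ι × Bool → β} (hg : Function.Injective g)
    [DecidablePred (· ∈ Set.range g)] {R : ι → Prop} [DecidablePred R] {e : Perm (ι × Bool)}
    (he : ∀ j b, e (j, b) = (j, if R j then !b else b)) (μ : Perm β) (hμ : ∀ w, μ (μ w) = w)
    (hmap : ∀ j, R j → ∃ j', R j' ∧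
      ((μ (g (j, false)) = g (j', false) ∧ μ (g (j, true)) = g (j', true)) ∨
        (μ (g (j, false)) = g (j', true) ∧ μ (g (j, true)) = g (j', false)))) :
    e.extendDomain (Equiv.ofInjective g hg) * μ = μ * e.extendDomain (Equiv.ofInjective g hg) := by
  set F := Equiv.ofInjective g hg
  have hFg : ∀ x, e.extendDomain F (g x) = g (e x) := fun x => e.extendDomain_apply_image F x
  -- on a rung seeing `R` the embedded flip exchanges the two sides
  have hflip : ∀ j, R j → e.extendDomain F (g (j, false)) = g (j, true) ∧
      e.extendDomain F (g (j, true)) = g (j, false) := fun j hj => by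
    simp only [hFg, he, if_pos hj, Bool.not_false, Bool.not_true, and_self]
  -- every point off the rungs seeing `R` is fixed
  have hfix : ∀ w, (¬∃ j, R j ∧ (w = g (j, false) ∨ w = g (j, true))) →
      e.extendDomain F w = w := by
    intro w hw
    by_cases hr : ∃ x, g x = w
    · obtain ⟨⟨j, b⟩, rfl⟩ := hr
      have hj : ¬R j := fun h => hw ⟨j, h, by cases b <;> simp⟩
      rw [hFg, he, if_neg hj]
    · exact e.extendDomain_apply_not_subtype F (by rintro ⟨x, hx⟩; exact hr ⟨x, hx⟩)
  ext w : 1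
  rw [Perm.mul_apply, Perm.mul_apply]
  by_cases hw : ∃ j, R j ∧ (w = g (j, false) ∨ w = g (j, true))
  · -- on the rungs seeing `R`: four cases (side of `w`, sides preserved or swapped)
    obtain ⟨j, hj, hw⟩ := hw
    obtain ⟨j', hj', hmap'⟩ := hmap j hj
    obtain ⟨hjf, hjt⟩ := hflip j hj
    obtain ⟨hjf', hjt'⟩ := hflip j' hj'
    rcases hw with rfl | rfl <;> rcases hmap' with ⟨h0, h1⟩ | ⟨h0, h1⟩
    · rw [h0, hjf', hjf, h1]
    · rw [h0, hjt', hjf, h1]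
    · rw [h1, hjt', hjt, h0]
    · rw [h1, hjf', hjt, h0]
  · -- off these rungs both sides fix `w`: the rungs seeing `R` are `μ`-stable
    rw [hfix w hw, hfix (μ w) ?_]
    rintro ⟨j, hj, hjw⟩
    obtain ⟨j', hj', hmap'⟩ := hmap j hj
    refine hw ⟨j', hj', ?_⟩
    rcases hjw with h | h <;> rcases hmap' with ⟨h0, h1⟩ | ⟨h0, h1⟩
    · exact Or.inl (by rw [← hμ w, h, h0])
    · exact Or.inr (by rw [← hμ w, h, h0])
    · exact Or.inr (by rw [← hμ w, h, h1])
    · exact Or.inl (by rw [← hμ w, h, h1])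

/-- Cyclic index bookkeeping: the rung before rung `0` is the last rung. [folklore] -/
theorem zero_sub_one (k : ℕ) : (0 : Fin (k + 2)) - 1 = Fin.last (k + 1) := by
  rw [sub_eq_iff_eq_add, Fin.last_add_one]

/-- Cyclic index bookkeeping: the rung before rung `j.succ` is rung `j.castSucc`. [folklore] -/
theorem succ_sub_one {k : ℕ} (j : Fin (k + 1)) : (j.succ : Fin (k + 2)) - 1 = j.castSucc := by
  rw [sub_eq_iff_eq_add, Fin.coeSucc_eq_succ]

/-- The rung map of a clean Möbius cycle: if rung `i` sees colour `c` (`c` is the colour `col i`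
of the step out of rung `i` or the colour `col (i - 1)` of the step into rung `i`), then `μ c`
maps the rung `{p i, q i}` onto a rung `{p j, q j}` seeing `c`, either preserving the two sides
(inner steps) or swapping them (the wrap step). [folklore] -/
theorem rung_map {n k : ℕ} (μ : Fin 3 → Perm (Fin n)) (p q : Fin (k + 2) → Fin n)
    (col : Fin (k + 2) → Fin 3) (hμ : ∀ c v, μ c (μ c v) = v)
    (hstep : ∀ j : Fin (k + 1), μ (col j.castSucc) (p j.castSucc) = p j.succ ∧
      μ (col j.castSucc) (q j.castSucc) = q j.succ)
    (hwp : μ (col (Fin.last (k + 1))) (p (Fin.last (k + 1))) = q 0)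
    (hwq : μ (col (Fin.last (k + 1))) (q (Fin.last (k + 1))) = p 0)
    (c : Fin 3) (i : Fin (k + 2)) (hi : col i = c ∨ col (i - 1) = c) :
    ∃ j : Fin (k + 2), (col j = c ∨ col (j - 1) = c) ∧
      ((μ c (p i) = p j ∧ μ c (q i) = q j) ∨ (μ c (p i) = q j ∧ μ c (q i) = p j)) := by
  rcases hi with hi | hi
  · -- the step out of rung `i` has colour `c`
    rcases Fin.eq_castSucc_or_eq_last i with ⟨j, rfl⟩ | rfl
    · -- the inner step from rung `j.castSucc` to rung `j.succ`
      subst hi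
      exact ⟨j.succ, Or.inr (by rw [succ_sub_one]), Or.inl (hstep j)⟩
    · -- the wrap step from the last rung to rung `0`, sides swapped
      subst hi
      exact ⟨0, Or.inr (by rw [zero_sub_one]), Or.inr ⟨hwp, hwq⟩⟩
  · -- the step into rung `i` has colour `c`; walk it backwards
    rcases Fin.eq_zero_or_eq_succ i with rfl | ⟨j, rfl⟩
    · -- the wrap step, sides swapped
      rw [zero_sub_one] at hi
      subst hi
      exact ⟨Fin.last (k + 1), Or.inl rfl, Or.inr ⟨by rw [← hwq, hμ], by rw [← hwp, hμ]⟩⟩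
    · -- the inner step from rung `j.castSucc` to rung `j.succ`
      rw [succ_sub_one] at hi
      subst hi
      refine ⟨j.castSucc, Or.inl rfl, Or.inl ⟨?_, ?_⟩⟩
      · conv_lhs => rw [← (hstep j).1]
        exact hμ _ _
      · conv_lhs => rw [← (hstep j).2]
        exact hμ _ _

end MobiusGadget

open MobiusGadget in
/-- **Stub `stub_mobiusGadget` — the Möbius gadget** (line `refutation-local-symmetry` of crux
`SnSubsetDichotomy.HyperoctahedralThreshold`, stmt-MatrixMultiplication-10883).  A clean Möbius
cycle of the rung graph of three involutions `μ 0, μ 1, μ 2` of `Fin n` (`k + 2` rungs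
`{p i, q i}`, inner steps side-preserving, the closing step side-swapping, consecutive step colours
distinct including the wrap) carries a commuting pair of involutions `a ∈ C(μ 0)`, `b ∈ C(μ 1)`,
not both trivial, with `a * b ∈ C(μ 2)`, supported on the points of the cycle: `a` (resp. `b`,
`a * b`) is the product of the rung transpositions `(p i q i)` over the rungs seeing colour `0`
(resp. `1`, `2`), realised as `Equiv.Perm.extendDomain` of a Boolean flip along the point
injection `Fin (k + 2) × Bool → Fin n` (`MobiusGadget.extendDomain_flip_comm`,
`MobiusGadget.rung_map`); the swap of sides at the wrap is invisible to the rung transpositions.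
[folklore] -/
theorem stub_mobiusGadget : ∀ (n k : ℕ) (μ : Fin 3 → Equiv.Perm (Fin n)) (p q : Fin (k + 2) → Fin n) (col : Fin (k + 2) → Fin 3), (∀ c, μ c * μ c = 1) → Function.Injective p → Function.Injective q → (∀ i j, p i ≠ q j) → (∀ j : Fin (k + 1), μ (col j.castSucc) (p j.castSucc) = p j.succ ∧ μ (col j.castSucc) (q j.castSucc) = q j.succ) → μ (col (Fin.last (k + 1))) (p (Fin.last (k + 1))) = q 0 → μ (col (Fin.last (k + 1))) (q (Fin.last (k + 1))) = p 0 → (∀ i : Fin (k + 1), col i.castSucc ≠ col i.succ) → col (Fin.last (k + 1)) ≠ col 0 → ∃ a b : Equiv.Perm (Fin n), a * a = 1 ∧ b * b = 1 ∧ a * b = b * a ∧ (a ≠ 1 ∨ b ≠ 1) ∧ a * μ 0 = μ 0 * a ∧ b * μ 1 = μ 1 * b ∧ a * b * μ 2 = μ 2 * (a * b) ∧ (∀ v, (a v ≠ v ∨ b v ≠ v) → ∃ i, v = p i ∨ v = q i) := by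
  intro n k μ p q col hμ hp hq hpq hstep hwp hwq hcol hwrap
  classical
  have hμv : ∀ c v, μ c (μ c v) = v := fun c v => by
    rw [← Perm.mul_apply, hμ c, Perm.one_apply]
  -- rung `i` sees the two distinct colours `col i` (outgoing) and `col (i - 1)` (incoming)
  have hsee : ∀ i : Fin (k + 2), col i ≠ col (i - 1) := fun i => by
    rcases Fin.eq_zero_or_eq_succ i with rfl | ⟨j, rfl⟩
    · rw [zero_sub_one]
      exact hwrap.symm
    · rw [succ_sub_one]
      exact (hcol j).symm
  -- the points of the cycle: `(i, false) ↦ p i`, `(i, true) ↦ q i`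
  obtain ⟨g, hgp, hgq⟩ : ∃ g : Fin (k + 2) × Bool → Fin n,
      (∀ j, g (j, false) = p j) ∧ ∀ j, g (j, true) = q j :=
    ⟨fun x => bif x.2 then q x.1 else p x.1, fun _ => rfl, fun _ => rfl⟩
  have hg : Function.Injective g := by
    rintro ⟨i, _ | _⟩ ⟨j, _ | _⟩ h <;> simp only [hgp, hgq] at h
    · rw [hp h]
    · exact absurd h (hpq i j)
    · exact absurd h.symm (hpq j i)
    · rw [hq h]
  -- `R c i`: rung `i` sees colour `c`
  obtain ⟨R, hR⟩ : ∃ R : Fin 3 → Fin (k + 2) → Prop,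
      ∀ c i, R c i ↔ (col i = c ∨ col (i - 1) = c) :=
    ⟨fun c i => col i = c ∨ col (i - 1) = c, fun _ _ => Iff.rfl⟩
  -- the local flips: swap the two sides of the rungs seeing `c`
  obtain ⟨e, he⟩ : ∃ e : Fin 3 → Perm (Fin (k + 2) × Bool),
      ∀ c j b, e c (j, b) = (j, if R c j then !b else b) :=
    ⟨fun c => Function.Involutive.toPerm (fun x => (x.1, if R c x.1 then !x.2 else x.2))
      fun x => by by_cases h : R c x.1 <;> simp [h], fun _ _ _ => rfl⟩
  -- transported to `Fin n` along `g`
  set F := Equiv.ofInjective g hg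
  have hFg : ∀ (f : Perm (Fin (k + 2) × Bool)) (x), f.extendDomain F (g x) = g (f x) :=
    fun f x => f.extendDomain_apply_image F x
  have hFfix : ∀ (f : Perm (Fin (k + 2) × Bool)) (w), (∀ x, g x ≠ w) → f.extendDomain F w = w :=
    fun f w hw => f.extendDomain_apply_not_subtype F (by rintro ⟨x, hx⟩; exact hw x hx)
  -- the three local involutions commute with their colours
  have hcomm : ∀ c, (e c).extendDomain F * μ c = μ c * (e c).extendDomain F := fun c =>
    extendDomain_flip_comm hg (he c) (μ c) (hμv c) fun j hj => by
      obtain ⟨j', hj', hmap⟩ := rung_map μ p q col hμv hstep hwp hwq c j ((hR c j).1 hj)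
      refine ⟨j', (hR c j').2 hj', ?_⟩
      simpa only [hgp, hgq] using hmap
  -- flip algebra: every rung sees exactly two of the three colours
  have h3 : ∀ j, R 2 j ↔ ¬(R 0 j ↔ R 1 j) := fun j => by
    rw [hR, hR, hR]
    have key : ∀ x y : Fin 3, x ≠ y →
        ((x = 2 ∨ y = 2) ↔ ¬((x = 0 ∨ y = 0) ↔ (x = 1 ∨ y = 1))) := by decide
    exact key _ _ (hsee j)
  have hsq : ∀ c, e c * e c = 1 := fun c => by
    ext ⟨j, b⟩ : 1
    simp only [Perm.mul_apply, Perm.one_apply, he]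
    by_cases h : R c j <;> simp [h]
  have h01 : e 0 * e 1 = e 1 * e 0 := by
    ext ⟨j, b⟩ : 1
    simp only [Perm.mul_apply, he]
    by_cases h0 : R 0 j <;> by_cases h1 : R 1 j <;> simp [h0, h1]
  have h012 : e 0 * e 1 = e 2 := by
    ext ⟨j, b⟩ : 1
    simp only [Perm.mul_apply, he]
    have := h3 j
    by_cases h0 : R 0 j <;> by_cases h1 : R 1 j <;> simp_all
  refine ⟨(e 0).extendDomain F, (e 1).extendDomain F, ?_, ?_, ?_, ?_, hcomm 0, hcomm 1, ?_, ?_⟩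
  · rw [Perm.extendDomain_mul, hsq, Perm.extendDomain_one]
  · rw [Perm.extendDomain_mul, hsq, Perm.extendDomain_one]
  · rw [Perm.extendDomain_mul, Perm.extendDomain_mul, h01]
  · -- not both trivial: rung `0` sees colour `0` or colour `1`
    have hR01 : R 0 0 ∨ R 1 0 := by
      rw [hR, hR]
      have key : ∀ x y : Fin 3, x ≠ y → (x = 0 ∨ y = 0) ∨ (x = 1 ∨ y = 1) := by decide
      exact key _ _ (hsee 0)
    have hne : ∀ c, R c 0 → (e c).extendDomain F ≠ 1 := fun c hc h1 => by
      have h := Equiv.congr_fun h1 (p 0)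
      rw [Perm.one_apply, ← hgp, hFg, he, if_pos hc, Bool.not_false, hgq, hgp] at h
      exact hpq 0 0 h.symm
    exact hR01.imp (hne 0) (hne 1)
  · rw [Perm.extendDomain_mul, h012]
    exact hcomm 2
  · -- support
    intro v hv
    by_contra hv'
    push Not at hv'
    have hgv : ∀ x, g x ≠ v := by
      rintro ⟨i, _ | _⟩
      · rw [hgp]
        exact (hv' i).1.symm
      · rw [hgq]
        exact (hv' i).2.symm
    exact hv.elim (fun h => h (hFfix _ v hgv)) fun h => h (hFfix _ v hgv)

end Summit.MatrixMultiplication.MatrixMultiplication.Theorems.HyperoctahedralThreshold
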